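import Mathlib
import Literature.Computability.Complexity.ExtMonotoneGates
import Literature.Computability.Complexity.CliqueApproximatorsWide
import Literature.Computability.Complexity.RossmanMonotoneCliqueProb
import Summits.PneNP.PneNP.Theorems.ConvexRankGatesLinAlgGateBlindDefs
import Summits.PneNP.PneNP.Theorems.ConvexRankGatesLinAlgGateBlindKonigDuality
import Summits.PneNP.PneNP.Theorems.ConvexRankGatesLinAlgGateBlindSGPermCalibration

/-!
# Calibration of the child `SGHallCover` of crux `LinAlgGateBlind` (stmt-PneNP-10681, route ConvexRankGates)

The second child of the strategist's split (`Cruxes/LinAlgGateBlind/SPLIT.md`) is the single-gate statement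
`SGHallCover`: every HALL-COVER term gate — "REJECT iff some vertex cover `(A, W)` with `#A + #W < θ` covers the
OR-pattern `P₀ ∪ ⋃_{atom on} P_a ⊆ [d′]²`, `d′ ≤ m^c`" (by Kőnig–Egerváry, "ACCEPT iff the pattern has `θ` cells in
pairwise distinct rows and columns", i.e. a `θ`-matching: the bipartite-matching / Edmonds pattern gate) — over
`≤ lOf m`-clique atoms has a one-sided small-clique DNF approximator on (bare `kOf m`-cliques, `G(m, qOf m)`).
Its informal text names the violator profile "CLIQUE-detection as a monotone projection of `BPM_{m^c}`, open
since Skyum–Valiant / Grigni–Sipser". This file makes that calibration a kernel-checked implication, with the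
child statement VERBATIM as hypothesis (class predicate written out exactly as in `SPLIT.md`):

* `sgHallCover_forces_oneCoverGate_blind` — `SGHallCover` ⟹ for every `c`, eventually in `m`, NO cover gate of
  dimension `d′ ≤ m^c` (constant cells `P₀`, cells `P i` owned by wires reading edges, threshold `θ`) computes
  `CLIQUE(m, ⌈m^{1/8}⌉₊)` in the form "`CLIQUE = 0` iff a vertex cover of size `< θ` exists";
* `sgHallCover_forces_oneMatchingGate_blind` — equivalently (`exists_matching_iff_forall_cover`, the landed
  Kőnig–Egerváry duality) NO gate "`CLIQUE = 1` iff the pattern `P₀ ∪ ⋃_{x (w i) = 1} P i` has `θ` cells with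
  pairwise distinct rows and pairwise distinct columns" with `d′ ≤ m^c` computes it: `CLIQUE(m, ⌈m^{1/8}⌉₊)` is
  not a polynomial-size monotone projection (wires ↦ cells, constants allowed) of bipartite `θ`-matching.

Both are one-line consequences of the class-free `not_computes_cliqueFn_of_sgAt` and the dense-regime numerics
`sgPerm_numerics` of the sibling `…SGPermCalibration`. Nothing here claims `SGHallCover`.
Sources: Kőnig 1931 / Egerváry 1931 (duality, tree theorem `exists_matching_iff_forall_cover`); Edmonds 1967 §5
(pattern gates); Alon–Boppana 1987 §3 (referee pair). [folklore]
-/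

-- `Summit.PneNP.PneNP.…` duplicates `PneNP` BY DESIGN (single-problem summit).
set_option linter.dupNamespace false

noncomputable section

namespace Summit.PneNP.PneNP.Theorems

open scoped BigOperators
open Finset Filter Literature.Computability.Complexity Razborov
open Summit.PneNP.PneNP.Cruxes.LinAlgGateBlind.DnfInvariantWideGatesSeeSmallCliques

/-- **`SGHallCover` forbids one-cover-gate CLIQUE at every polynomial dimension.** With the child statement
`SGHallCover` verbatim as hypothesis: for every `c`, eventually in `m`, no Hall-cover gate of dimension
`d′ ≤ m^c` wired to the edges computes `CLIQUE(m, ⌈m^{1/8}⌉₊)` ("reject iff a vertex cover of size `< θ`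
covers `P₀ ∪ ⋃_{x (w i) = 1} P i`"). [folklore] -/
theorem sgHallCover_forces_oneCoverGate_blind : (∀ c : ℕ, ∀ᶠ m : ℕ in atTop, SGAt m (fun g : GateFn => ∃ d' θ : ℕ, d' ≤ m ^ c ∧ ∃ (P₀ : Set (Fin d' × Fin d')) (P : Fin g.1 → Set (Fin d' × Fin d')), ∀ v : Fin g.1 → Bool, g.2 v = false ↔ ∃ A W : Finset (Fin d'), A.card + W.card < θ ∧ ∀ x ∈ {x : Fin d' × Fin d' | x ∈ P₀ ∨ ∃ i, v i = true ∧ x ∈ P i}, x.1 ∈ A ∨ x.2 ∈ W) (lOf m) (kOf m) (qOf m) (epsOf c m)) → ∀ c : ℕ, ∀ᶠ m : ℕ in atTop, ∀ (d' θ : ℕ), d' ≤ m ^ c → ∀ (P₀ : Set (Fin d' × Fin d')) (n : ℕ) (P : Fin n → Set (Fin d' × Fin d')) (w : Fin n → KEdge m), ¬ ∀ x : KEdge m → Bool, (cliqueFn m (kOf m) x = false ↔ ∃ A W : Finset (Fin d'), A.card + W.card < θ ∧ ∀ y ∈ {y : Fin d' × Fin d' | y ∈ P₀ ∨ ∃ i,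 x (w i) = true ∧ y ∈ P i}, y.1 ∈ A ∨ y.2 ∈ W) := by
  intro hSG c
  filter_upwards [hSG c, sgPerm_numerics c] with m hSGm ⟨hl, hk, hkm, hq0, hq1, hε, hgap⟩ d' θ hd P₀ n P w
    hcomp
  classical
  -- the cover gate, as a `GateFn` of arity `n`
  let Q : (Fin n → Bool) → Prop := fun v => ∃ A W : Finset (Fin d'), A.card + W.card < θ ∧
    ∀ y ∈ {y : Fin d' × Fin d' | y ∈ P₀ ∨ ∃ i, v i = true ∧ y ∈ P i}, y.1 ∈ A ∨ y.2 ∈ W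
  let g : GateFn := ⟨n, fun v => decide (¬ Q v)⟩
  have hgQ : ∀ v, g.2 v = false ↔ Q v := fun v => by
    change decide (¬ Q v) = false ↔ Q v
    rw [decide_eq_false_iff_not, not_not]
  refine not_computes_cliqueFn_of_sgAt hl hk hkm hq0 hq1 hε hgap hSGm (g := g)
    ⟨d', θ, hd, P₀, P, fun v => hgQ v⟩ w fun x => ?_
  -- `g (x ∘ w) = CLIQUE(x)`: two Booleans with the same `= false` condition agree
  have key : g.2 (fun i => x (w i)) = false ↔ cliqueFn m (kOf m) x = false := (hgQ _).trans (hcomp x).symm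
  revert key
  cases g.2 (fun i => x (w i)) <;> cases cliqueFn m (kOf m) x <;> simp

/-- **`CLIQUE(m, ⌈m^{1/8}⌉₊)` is not a polynomial-size monotone projection of bipartite `θ`-matching** — given
`SGHallCover`. With the child statement verbatim as hypothesis: for every `c`, eventually in `m`, no gate
"accept iff the pattern `P₀ ∪ ⋃_{x (w i) = 1} P i ⊆ [d′]²` has `θ` cells with pairwise distinct rows and
pairwise distinct columns", `d′ ≤ m^c`, computes `CLIQUE(m, ⌈m^{1/8}⌉₊)` (Kőnig–Egerváry,
`exists_matching_iff_forall_cover`, turns it into the cover gate of `sgHallCover_forces_oneCoverGate_blind`).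
[folklore] -/
theorem sgHallCover_forces_oneMatchingGate_blind : (∀ c : ℕ, ∀ᶠ m : ℕ in atTop, SGAt m (fun g : GateFn => ∃ d' θ : ℕ, d' ≤ m ^ c ∧ ∃ (P₀ : Set (Fin d' × Fin d')) (P : Fin g.1 → Set (Fin d' × Fin d')), ∀ v : Fin g.1 → Bool, g.2 v = false ↔ ∃ A W : Finset (Fin d'), A.card + W.card < θ ∧ ∀ x ∈ {x : Fin d' × Fin d' | x ∈ P₀ ∨ ∃ i, v i = true ∧ x ∈ P i}, x.1 ∈ A ∨ x.2 ∈ W) (lOf m) (kOf m) (qOf m) (epsOf c m)) → ∀ c : ℕ, ∀ᶠ m : ℕ in atTop, ∀ (d' θ : ℕ), d' ≤ m ^ c → ∀ (P₀ : Set (Fin d' × Fin d')) (n : ℕ) (P : Fin n → Set (Fin d' × Fin d')) (w : Fin n → KEdge m), ¬ ∀ x : KEdge m → Bool, (cliqueFn m (kOf m) x = true ↔ ∃ (r s : Fin θ → Fin d'), Function.Injective r ∧ Function.Injective s ∧ ∀ j, (r j, s j) ∈ {y : Fin d' × Fin d' | y ∈ P₀ ∨ ∃ i, x (w i) = true ∧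 y ∈ P i}) := by
  intro hSG c
  filter_upwards [sgHallCover_forces_oneCoverGate_blind hSG c] with m hm d' θ hd P₀ n P w hcomp
  classical
  refine hm d' θ hd P₀ n P w fun x => ?_
  -- Kőnig–Egerváry for the pattern of `x`: `θ`-matching iff every cover has `≥ θ` vertices
  have hK := exists_matching_iff_forall_cover
    (fun a b : Fin d' => (a, b) ∈ P₀ ∨ ∃ i, x (w i) = true ∧ (a, b) ∈ P i) θ
  have hcov : (∃ A W : Finset (Fin d'), A.card + W.card < θ ∧ ∀ y : Fin d' × Fin d',
      (y ∈ P₀ ∨ ∃ i, x (w i) = true ∧ y ∈ P i) → y.1 ∈ A ∨ y.2 ∈ W) ↔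
      ¬ ∀ (A W : Finset (Fin d')), (∀ a b : Fin d', ((a, b) ∈ P₀ ∨ ∃ i, x (w i) = true ∧ (a, b) ∈ P i) →
        a ∈ A ∨ b ∈ W) → θ ≤ #A + #W := by
    constructor
    · rintro ⟨A, W, hlt, hAW⟩ hall
      exact absurd (hall A W fun a b hab => hAW (a, b) hab) (by omega)
    · intro h
      simp only [not_forall, not_le, exists_prop] at h
      obtain ⟨A, W, hAW, hlt⟩ := h
      exact ⟨A, W, hlt, fun y hy => hAW y.1 y.2 hy⟩
  have hc : cliqueFn m (kOf m) x = true ↔ ∀ (A W : Finset (Fin d')),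
      (∀ a b : Fin d', ((a, b) ∈ P₀ ∨ ∃ i, x (w i) = true ∧ (a, b) ∈ P i) → a ∈ A ∨ b ∈ W) →
        θ ≤ #A + #W := (hcomp x).trans hK
  have goal : cliqueFn m (kOf m) x = false ↔ ∃ A W : Finset (Fin d'), A.card + W.card < θ ∧
      ∀ y : Fin d' × Fin d', (y ∈ P₀ ∨ ∃ i, x (w i) = true ∧ y ∈ P i) → y.1 ∈ A ∨ y.2 ∈ W := by
    rw [hcov, ← hc]
    cases cliqueFn m (kOf m) x <;> simp
  simpa only [Set.mem_setOf_eq] using goal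

end Summit.PneNP.PneNP.Theorems

end
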